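import Summits.ResolutionOfSingularities.ResolutionOfSingularities.Theorems.MarkedTransferCampaignW12SandwichK11ReproW2
import Summits.ResolutionOfSingularities.ResolutionOfSingularities.Theorems.MarkedTransferCampaignW12K12Witnesses
import Mathlib.RingTheory.MvPolynomial.Ideal
import Mathlib.Data.Fin.VecNotation
import Mathlib.Tactic.FinCases
import Mathlib.Tactic.LinearCombination
import HarnessLib

/-!
# [OURS · L1 W1.2 · K1.2 blind reproduction, part 2] Box coefficients of `℘(E,2)` on the witness
# `W3 = ((y² + yx⁴ + yx² + x⁴), 2) ⊂ 𝔸²` (`p = 2`, `ξ = 0`, `q = m = 2`, `e = 1`) from the `x`-chart of the blow-up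
# at `ξ`; the no-unit property of its sandwich negative modules (res-L1-k11, gen 2). Part 3 (same method,
# `W1 = ((y² + xw²), 2) ⊂ 𝔸³` via a `Z[t]`-chart) is `MarkedTransferCampaignW12SandwichK11ReproW1.lean`.

Companion of `MarkedTransferCampaignW12SandwichK11ReproW2.lean` (part 1: the witness `W2`, and the multiples-only
no-unit lemma `K11Repro.sandwichNegaNoUnit_of_multiples`). INDEPENDENT («blind») re-derivation of the witnesses of
res-L1-k12's registered kill test K1.2 (HOME/STATUS.md 2026-08-26T19:41:04Z); object = the typed
`Campaign.sandwichPNega p e P m a` (res-L1-type-o2, p461383). PROOFS ONLY — every polynomial is written out; §0 holds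
the generic lemmas on `𝔪_ξ^{[2]} = (X_i²)` used by parts 2 and 3.

HOW `℘(E,·)` ENTERS (hypotheses on an abstract family `P : ℕ → Ideal O`, `P j` standing for `℘(E,j)`; each is an
instance of the manuscript's GEOMETRIC DEFINITION of `℘` (p.17 l.1–2: «`℘(E,a)` … the union of those ideals `I` such
that `𝔖(I,a) ⊃ 𝔖(J,b)`», with `𝔖` = the LSBs over `Z[t]` permissible for `E[t]`, Def 2.4–2.5 p.6 l.1–12) — a
CANDIDATE [claim: Hironaka2017, status: under-review] consumed as a hypothesis, never asserted):
* (ORD) `P j ⊆ 𝔪_ξ^j` for all `j` — the closed point `ξ ∈ Sing(E)` is a permissible centre, so `ord_ξ f ≥ j` for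
  `f ∈ ℘(E,j)`; at polynomial level `𝔪_ξ^j = idealOfVars^j` = «every monomial has degree `≥ j`».
* (LSB) for `f ∈ P 2`, ONE explicit chart condition `φ f ∈ (exc)² · I_C²`, where `φ` is the chart map of a blow-up
  permissible for `E`, `exc` the exceptional equation and `C ⊂ Sing(E′)` the next centre read in the chart. For
  `W3`: blow-up of `𝔸²` at `ξ`; `x`-chart `φ: x ↦ x, y ↦ xy₁`; `exc = x`; `C = ξ′ =` origin of the chart, which lies in
  `Sing(E′)` because `g′ = y₁² + x³y₁ + xy₁ + x² ∈ (x,y₁)²` (`W3_chart_g`); the hypothesis `φ f ∈ (x²)·(x,y₁)²` says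
  «the transform `(f′,2)` of `((f),2)` exists on the chart and has order `≥ 2` at `ξ′`».

WHAT IS PROVED (sorry-free; `O = 𝔽₂[x,y]`, `Fin 2`: `0 = x`, `1 = y`; `𝔪_ξ = idealOfVars`, `𝔪_ξ^{[2]} = (x², y²)`):
* §0 (any `σ`): `𝔪_ξ^{[2]} = (X_i²)` is generated by elements of `ρ(O)`, membership from the support, `𝔪_ξ⁴ ⊆ 𝔪_ξ^{[2]}`
  in three variables and `𝔪_ξ³ ⊆ 𝔪_ξ^{[2]}` in two (a monomial of degree `> n(q−1)` has an exponent `≥ q`).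
* `W3_P2_le_span_sq`: (LSB) alone forces all four box coefficients `1, x, y, xy` of every `f ∈ P 2` to vanish (the
  chart's exponent map `(i,j) ↦ (i+j, j)` is injective, `W3_coeff_chart`), i.e. `P 2 ⊆ 𝔪_ξ^{[2]}`.
* `W3_sandwichNegaNoUnit`: with (ORD) for the degrees `2n ≥ 4`, `sandwichPNega 2 1 P 2 a ⊆ 𝔪_ξ^{[2]} ⊆ 𝔪_ξ` for ALL
  `a`, hence `Campaign.SandwichNegaNoUnit 2 1 P 2` — the ALIVE-type certificate shape of the K1.2 registration for `W3`.
* `W3_hypotheses_nonvacuous`: the family `P j = if j = 2 then (g) else 0` satisfies (ORD)+(LSB).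
DEDUP NOTE (blind protocol): the two `E`-side memberships `g ∈ 𝔪_ξ²` and `g′ ∈ (x,y₁)²` were written here independently
and turned out to be verbatim the already-landed `Campaign.g3_mem_sq` / `Campaign.g3'_mem_sq` of res-L1-k12's
`MarkedTransferCampaignW12K12Witnesses.lean` (gate `dedup.landed` at dry-run); per the gate's rule those two are now
IMPORTED by name and not restated — nothing else of that file is used or was read.

HONEST FRAMING. Nothing here is a statement of H. Hironaka's manuscript *Resolution of singularities in positive
characteristics* (2017-03-23, [Hironaka2017], lit key `paper:url-3343fd9e678b`), nothing asserts or denies any of its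
statements, no verdict on K1.2 (res-L1-k12 scores it) or on GAP-LEDGER rows R05/R08 is implied, and nothing here
is progress on resolution of singularities in positive characteristic. AI proof is weaker than expert review.
-/

noncomputable section

set_option linter.dupNamespace false -- mandated namespace of this single-conjunct summit

namespace Summit.ResolutionOfSingularities.ResolutionOfSingularities.Theorems.Campaign.K11Repro

open MvPolynomial
open Literature.AlgebraicGeometry.Resolution
open Literature.AlgebraicGeometry.Hironaka2017
open Summit.ResolutionOfSingularities.ResolutionOfSingularities.Theorems.Campaign

/-! ## §0 Generic: the Frobenius power `𝔪_ξ^{[2]} = (X_i² : i)` of the ideal of the origin -/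

section SpanSq

variable {σ : Type*}

/-- `(X_i²)_i` as monic monomials. [folklore] -/
theorem range_X_sq_eq_image :
    (Set.range fun i : σ => (X i : MvPolynomial σ (ZMod 2)) ^ 2) =
      (fun s : σ →₀ ℕ => monomial s (1 : ZMod 2)) '' Set.range fun i : σ => Finsupp.single i 2 := by
  ext f
  simp only [Set.mem_range, Set.mem_image, exists_exists_eq_and, X_pow_eq_monomial]

/-- Membership in `𝔪_ξ^{[2]} = (X_i²)` from the support: every monomial has some exponent `≥ 2`. [folklore] -/
theorem mem_span_sq_of_support (f : MvPolynomial σ (ZMod 2)) (h : ∀ β ∈ f.support, ∃ i, 2 ≤ β i) :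
    f ∈ Ideal.span (Set.range fun i : σ => (X i : MvPolynomial σ (ZMod 2)) ^ 2) := by
  rw [range_X_sq_eq_image, mem_ideal_span_monomial_image]
  intro β hβ
  obtain ⟨i, hi⟩ := h β hβ
  exact ⟨Finsupp.single i 2, ⟨i, rfl⟩, Finsupp.single_le_iff.mpr hi⟩

/-- The generators `X_i² = ρ(X_i)` lie in the sandwich base `ρ(O)` (`p = 2`, `e = 1`). [folklore] -/
theorem range_X_sq_subset_range_frobenius :
    (Set.range fun i : σ => (X i : MvPolynomial σ (ZMod 2)) ^ 2) ⊆
      Set.range (iterateFrobenius (MvPolynomial σ (ZMod 2)) 2 1) := by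
  rintro _ ⟨i, rfl⟩
  exact ⟨X i, by rw [iterateFrobenius_def, pow_one]⟩

/-- `𝔪_ξ^{[2]} ⊆ 𝔪_ξ = idealOfVars`. [folklore] -/
theorem span_sq_le_idealOfVars :
    Ideal.span (Set.range fun i : σ => (X i : MvPolynomial σ (ZMod 2)) ^ 2) ≤ idealOfVars σ (ZMod 2) := by
  refine Ideal.span_le.mpr ?_
  rintro _ ⟨i, rfl⟩
  exact Ideal.pow_mem_of_mem _ (Ideal.subset_span (Set.mem_range_self i)) 2 (by norm_num)

/-- `𝔪_ξ ≠ O` (`1 ∉ idealOfVars`). [folklore] -/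
theorem idealOfVars_ne_top : idealOfVars σ (ZMod 2) ≠ ⊤ := by
  intro h
  have h1 : (C 1 : MvPolynomial σ (ZMod 2)) ∈ idealOfVars σ (ZMod 2) ^ 1 := by
    rw [pow_one, h]; exact Submodule.mem_top
  rw [C_mem_pow_idealOfVars_iff] at h1
  rcases h1 with h1 | h1
  · exact one_ne_zero h1
  · exact one_ne_zero h1

end SpanSq

/-- Three variables: `𝔪_ξ⁴ ⊆ 𝔪_ξ^{[2]}` (a monomial of degree `≥ 4` in `x, y, w` has an exponent `≥ 2`). [folklore] -/
theorem pow_four_idealOfVars_le_span_sq :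
    idealOfVars (Fin 3) (ZMod 2) ^ 4 ≤ Ideal.span (Set.range fun i : Fin 3 => (X i : MvPolynomial (Fin 3) (ZMod 2)) ^ 2) := by
  intro f hf
  rw [mem_pow_idealOfVars_iff] at hf
  refine mem_span_sq_of_support f fun β hβ => ?_
  have h4 := hf β hβ
  rw [Finsupp.degree_eq_sum, Fin.sum_univ_three] at h4
  by_contra hne
  have h0 : β 0 < 2 := lt_of_not_ge fun h => hne ⟨0, h⟩
  have h1 : β 1 < 2 := lt_of_not_ge fun h => hne ⟨1, h⟩
  have h2 : β 2 < 2 := lt_of_not_ge fun h => hne ⟨2, h⟩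
  omega

/-- Two variables: `𝔪_ξ³ ⊆ 𝔪_ξ^{[2]}`. [folklore] -/
theorem pow_three_idealOfVars_le_span_sq :
    idealOfVars (Fin 2) (ZMod 2) ^ 3 ≤ Ideal.span (Set.range fun i : Fin 2 => (X i : MvPolynomial (Fin 2) (ZMod 2)) ^ 2) := by
  intro f hf
  rw [mem_pow_idealOfVars_iff] at hf
  refine mem_span_sq_of_support f fun β hβ => ?_
  have h3 := hf β hβ
  rw [Finsupp.degree_eq_sum, Fin.sum_univ_two] at h3
  by_contra hne
  have h0 : β 0 < 2 := lt_of_not_ge fun h => hne ⟨0, h⟩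
  have h1 : β 1 < 2 := lt_of_not_ge fun h => hne ⟨1, h⟩
  omega

/-! ## §1 `W3 = ((y² + yx⁴ + yx² + x⁴), 2) ⊂ 𝔸² = Spec 𝔽₂[x, y]` (`Fin 2`: `0 = x`, `1 = y`) -/

section W3

/-- The `x`-chart of the blow-up of `𝔸²` at `ξ`: `φ(g) = x²·g′` with strict transform `g′ = y₁² + x³y₁ + xy₁ + x²`
(`φ : x ↦ x, y ↦ x·y₁`; exceptional divisor `x = 0`). [folklore] -/
theorem W3_chart_g :
    aeval ![(X 0 : MvPolynomial (Fin 2) (ZMod 2)), X 0 * X 1]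
        (X 1 ^ 2 + X 1 * X 0 ^ 4 + X 1 * X 0 ^ 2 + X 0 ^ 4 : MvPolynomial (Fin 2) (ZMod 2)) =
      X 0 ^ 2 * (X 1 ^ 2 + X 0 ^ 3 * X 1 + X 0 * X 1 + X 0 ^ 2) := by
  simp only [map_add, map_mul, map_pow, aeval_X, Matrix.cons_val_zero, Matrix.cons_val_one]
  ring

/-- Non-vacuity / consistency: `g` passes its own chart test, `φ(g) ∈ (x²)·(x,y₁)²`. [folklore] -/
theorem W3_chart_g_mem :
    aeval ![(X 0 : MvPolynomial (Fin 2) (ZMod 2)), X 0 * X 1]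
        (X 1 ^ 2 + X 1 * X 0 ^ 4 + X 1 * X 0 ^ 2 + X 0 ^ 4 : MvPolynomial (Fin 2) (ZMod 2)) ∈
      Ideal.span {(X 0 : MvPolynomial (Fin 2) (ZMod 2)) ^ 2} * idealOfVars (Fin 2) (ZMod 2) ^ 2 := by
  rw [W3_chart_g]
  exact Ideal.mul_mem_mul (Ideal.subset_span rfl) g3'_mem_sq

/-- The chart map on monomials: `φ(xⁱyʲ) = xⁱ⁺ʲ y₁ʲ`. [folklore] -/
theorem W3_chart_monomial (α : Fin 2 →₀ ℕ) (c : ZMod 2) :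
    aeval ![(X 0 : MvPolynomial (Fin 2) (ZMod 2)), X 0 * X 1] (monomial α c) =
      monomial (Finsupp.single 0 (α 0 + α 1) + Finsupp.single 1 (α 1)) c := by
  rw [aeval_monomial, Finsupp.prod_fintype _ _ (fun i => by simp), Fin.prod_univ_two]
  simp only [Matrix.cons_val_zero, Matrix.cons_val_one, algebraMap_eq]
  rw [show C c * (X 0 ^ α 0 * (X 0 * X 1) ^ α 1) =
      C c * ((X 0 : MvPolynomial (Fin 2) (ZMod 2)) ^ (α 0 + α 1) * X 1 ^ α 1) by ring,
    X_pow_eq_monomial, X_pow_eq_monomial, monomial_mul, C_mul_monomial]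
  simp

/-- The exponent map `(i,j) ↦ (i+j, j)` of the chart is injective. [folklore] -/
theorem W3_expMap_injective (α β : Fin 2 →₀ ℕ)
    (h : Finsupp.single (0 : Fin 2) (β 0 + β 1) + Finsupp.single 1 (β 1) =
      Finsupp.single (0 : Fin 2) (α 0 + α 1) + Finsupp.single 1 (α 1)) : β = α := by
  have h0 := DFunLike.congr_fun h 0
  have h1 := DFunLike.congr_fun h 1
  simp only [Finsupp.coe_add, Pi.add_apply, Finsupp.single_apply] at h0 h1
  simp only [Fin.isValue, ↓reduceIte, one_ne_zero, zero_ne_one, add_zero, zero_add] at h0 h1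
  ext i; fin_cases i <;> simp <;> omega

/-- **Coefficient transport** along the chart: the coefficient of `xⁱ⁺ʲy₁ʲ` in `φ(f)` is the coefficient of `xⁱyʲ`
in `f`. [folklore] -/
theorem W3_coeff_chart (f : MvPolynomial (Fin 2) (ZMod 2)) (α : Fin 2 →₀ ℕ) :
    coeff (Finsupp.single 0 (α 0 + α 1) + Finsupp.single 1 (α 1))
        (aeval ![(X 0 : MvPolynomial (Fin 2) (ZMod 2)), X 0 * X 1] f) = coeff α f := by
  classical
  induction f using MvPolynomial.induction_on' with
  | monomial β c =>
    rw [W3_chart_monomial, coeff_monomial, coeff_monomial]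
    by_cases hβ : β = α
    · subst hβ; simp
    · rw [if_neg hβ, if_neg fun h => hβ (W3_expMap_injective α β h)]
  | add p q hp hq => rw [map_add, coeff_add, coeff_add, hp, hq]

/-- **(LSB) forces all four box coefficients `1, x, y, xy` of `f ∈ ℘(E,2)` to vanish: `P 2 ⊆ 𝔪_ξ^{[2]} = (x², y²)`.**
Hypothesis (LSB): for `f ∈ P 2`, `φ(f) ∈ (x²)·(x,y₁)²` — the transform `(f′,2)` of `((f),2)` under the blow-up at `ξ`
exists on the `x`-chart (`x² ∣ φ f`) and has order `≥ 2` at `ξ′ ∈ Sing(E′)`. [folklore] -/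
theorem W3_P2_le_span_sq (P : ℕ → Ideal (MvPolynomial (Fin 2) (ZMod 2)))
    (hLSB : ∀ f ∈ P 2, aeval ![(X 0 : MvPolynomial (Fin 2) (ZMod 2)), X 0 * X 1] f ∈
      Ideal.span {(X 0 : MvPolynomial (Fin 2) (ZMod 2)) ^ 2} * idealOfVars (Fin 2) (ZMod 2) ^ 2) :
    P 2 ≤ Ideal.span (Set.range fun i : Fin 2 => (X i : MvPolynomial (Fin 2) (ZMod 2)) ^ 2) := by
  intro f hf
  have hF := hLSB f hf
  -- `φ f ∈ (x²)` and `φ f ∈ 𝔪⁴`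
  have hF1 : aeval ![(X 0 : MvPolynomial (Fin 2) (ZMod 2)), X 0 * X 1] f ∈
      Ideal.span ((fun s : Fin 2 →₀ ℕ => monomial s (1 : ZMod 2)) '' {Finsupp.single 0 2}) := by
    rw [Set.image_singleton, ← X_pow_eq_monomial]
    exact Ideal.mul_le_right hF
  have hF2 : aeval ![(X 0 : MvPolynomial (Fin 2) (ZMod 2)), X 0 * X 1] f ∈ idealOfVars (Fin 2) (ZMod 2) ^ 4 := by
    have hx : Ideal.span {(X 0 : MvPolynomial (Fin 2) (ZMod 2)) ^ 2} ≤ idealOfVars (Fin 2) (ZMod 2) ^ 2 :=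
      (Ideal.span_singleton_le_iff_mem _).mpr (Ideal.pow_mem_pow (Ideal.subset_span (Set.mem_range_self 0)) 2)
    have := Ideal.mul_mono hx (le_refl (idealOfVars (Fin 2) (ZMod 2) ^ 2)) hF
    rwa [← pow_add] at this
  rw [mem_ideal_span_monomial_image] at hF1
  rw [mem_pow_idealOfVars_iff] at hF2
  refine mem_span_sq_of_support f fun α hα => ?_
  -- the transported exponent lies in the support of `φ f`
  have hmem : Finsupp.single 0 (α 0 + α 1) + Finsupp.single 1 (α 1) ∈
      (aeval ![(X 0 : MvPolynomial (Fin 2) (ZMod 2)), X 0 * X 1] f).support := by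
    rw [mem_support_iff, W3_coeff_chart]; exact mem_support_iff.mp hα
  obtain ⟨_, rfl, hle⟩ := hF1 _ hmem
  have hdeg := hF2 _ hmem
  rw [Finsupp.single_le_iff] at hle
  rw [Finsupp.degree_eq_sum, Fin.sum_univ_two] at hdeg
  simp only [Finsupp.coe_add, Pi.add_apply, Finsupp.single_apply] at hle hdeg
  simp only [Fin.isValue, ↓reduceIte, one_ne_zero, zero_ne_one, add_zero, zero_add] at hle hdeg
  by_contra hne
  have h0 : α 0 < 2 := lt_of_not_ge fun h => hne ⟨0, h⟩
  have h1 : α 1 < 2 := lt_of_not_ge fun h => hne ⟨1, h⟩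
  omega

/-- **ALIVE-type certificate shape for `W3`.** Under (ORD) and (LSB): `sandwichPNega 2 1 P 2 a ⊆ 𝔪_ξ^{[2]} ⊆ 𝔪_ξ` for
EVERY `a : ℕ`, and `Campaign.SandwichNegaNoUnit 2 1 P 2` (`1 ∉ ℘nega_sandwich(W3,−a)` for all `a > 0`). [folklore] -/
theorem W3_sandwichNegaNoUnit (P : ℕ → Ideal (MvPolynomial (Fin 2) (ZMod 2)))
    (hord : ∀ j : ℕ, P j ≤ idealOfVars (Fin 2) (ZMod 2) ^ j)
    (hLSB : ∀ f ∈ P 2, aeval ![(X 0 : MvPolynomial (Fin 2) (ZMod 2)), X 0 * X 1] f ∈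
      Ideal.span {(X 0 : MvPolynomial (Fin 2) (ZMod 2)) ^ 2} * idealOfVars (Fin 2) (ZMod 2) ^ 2) :
    (∀ a : ℕ, sandwichPNega 2 1 P 2 a ≤ idealOfVars (Fin 2) (ZMod 2)) ∧ SandwichNegaNoUnit 2 1 P 2 := by
  refine sandwichNegaNoUnit_of_multiples 2 1 range_X_sq_subset_range_frobenius span_sq_le_idealOfVars
    idealOfVars_ne_top fun n hn => ?_
  rcases Nat.lt_or_ge n 2 with h | h
  · obtain rfl : n = 1 := by omega
    simpa using W3_P2_le_span_sq P hLSB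
  · exact (hord _).trans ((Ideal.pow_le_pow_right (by omega)).trans pow_three_idealOfVars_le_span_sq)

/-- Non-vacuity: SOME family with `g ∈ P 2` satisfies (ORD) and (LSB) — namely `P j = if j = 2 then (g) else 0`
(`g` passes its own chart test). [folklore] -/
theorem W3_hypotheses_nonvacuous :
    ∃ P : ℕ → Ideal (MvPolynomial (Fin 2) (ZMod 2)),
      (X 1 ^ 2 + X 1 * X 0 ^ 4 + X 1 * X 0 ^ 2 + X 0 ^ 4 : MvPolynomial (Fin 2) (ZMod 2)) ∈ P 2 ∧
      (∀ j : ℕ, P j ≤ idealOfVars (Fin 2) (ZMod 2) ^ j) ∧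
      (∀ f ∈ P 2, aeval ![(X 0 : MvPolynomial (Fin 2) (ZMod 2)), X 0 * X 1] f ∈
        Ideal.span {(X 0 : MvPolynomial (Fin 2) (ZMod 2)) ^ 2} * idealOfVars (Fin 2) (ZMod 2) ^ 2) := by
  refine ⟨fun j => if j = 2 then
      Ideal.span {(X 1 ^ 2 + X 1 * X 0 ^ 4 + X 1 * X 0 ^ 2 + X 0 ^ 4 : MvPolynomial (Fin 2) (ZMod 2))} else ⊥,
    ?_, fun j => ?_, fun f hf => ?_⟩
  · simp only [↓reduceIte]
    exact Ideal.mem_span_singleton_self _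
  · by_cases hj : j = 2
    · subst hj
      simp only [↓reduceIte]
      exact (Ideal.span_singleton_le_iff_mem _).mpr g3_mem_sq
    · simp [hj]
  · simp only [↓reduceIte] at hf
    obtain ⟨c, rfl⟩ := Ideal.mem_span_singleton'.mp hf
    rw [map_mul]
    exact Ideal.mul_mem_left _ _ W3_chart_g_mem

end W3


end Summit.ResolutionOfSingularities.ResolutionOfSingularities.Theorems.Campaign.K11Repro

end
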